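import Mathlib
import HarnessLib
import Literature.Geometry.DiscreteGeometry.LegendreThreePSD

/-!
# Bond-to-cap certificate: the valid inequalities (Legendre coupling with the pole, bond counts)

Route `PricedLinkCensus`, item `SoftFourRings` (stmt-AtomisticToContinuum-14234), bond-to-cap
step (seat c3).  Elementary bookkeeping used by the certificate:

* `legendre_pole_coupling` — for a unit pole `p ∉ X` and unit vectors `X`, positivity of the
  Legendre kernel on the thirteen points `{p} ∪ X` with weights `(β, γ, …, γ)`:
  `β² L_l(1) + 2βγ Σ_x L_l(⟪p,x⟫) + γ² Σ_{x,y} L_l(⟪x,y⟫) ≥ 0`, `L_l(t) = legendreI l t 1 = 2^l P_l(t)`;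
* `card_filter_bond_eq_four`, `card_filter_nonbond_eq_seven`, `sum_split_bond` — at a point of a
  twelve-point set with exactly four bonds, a sum over the set splits as the diagonal term, four
  bonded terms and seven non-bonded terms.
-/

namespace Summit.AtomisticToContinuum.Crystallization.Theorems.Cap

open Real RealInnerProductSpace Literature.Geometry.DiscreteGeometry Finset

/-- **Legendre positivity on the pole and the configuration.**  For a unit vector `p ∉ X`, unit
vectors `X` and reals `β, γ`:
`0 ≤ β² L_l(1) + 2βγ Σ_{x∈X} L_l(⟪p,x⟫) + γ² Σ_{x,y∈X} L_l(⟪x,y⟫)` with `L_l(t) = legendreI l t 1`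
(Schoenberg positivity of `P_l` on the thirteen points `{p} ∪ X` with weights `(β, γ, …, γ)`).
[folklore] -/
theorem legendre_pole_coupling (l : ℕ) (β γ : ℝ) {p : EuclideanSpace ℝ (Fin 3)} (hp : ‖p‖ = 1)
    {X : Finset (EuclideanSpace ℝ (Fin 3))} (hX1 : ∀ x ∈ X, ‖x‖ = 1) (hpX : p ∉ X) :
    0 ≤ β ^ 2 * legendreI l 1 1 + 2 * β * γ * ∑ x ∈ X, legendreI l ⟪p, x⟫ 1 +
      γ ^ 2 * ∑ x ∈ X, ∑ y ∈ X, legendreI l ⟪x, y⟫ 1 := by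
  classical
  set c : EuclideanSpace ℝ (Fin 3) → ℝ := fun y => if y = p then β else γ with hc
  have h := sum_sum_legendreI_nonneg l (insert p X) c id
  have hcp : c p = β := by simp [hc]
  have hcx : ∀ x ∈ X, c x = γ := by
    intro x hx
    have : x ≠ p := fun h => hpX (h ▸ hx)
    simp [hc, this]
  have hnorm : ∀ y ∈ insert p X, ‖y‖ = 1 := by
    intro y hy
    rcases Finset.mem_insert.1 hy with rfl | hy
    · exact hp
    · exact hX1 y hy
  have hpp : ⟪p, p⟫ = 1 := by rw [real_inner_self_eq_norm_sq, hp]; norm_num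
  -- rewrite the norms to 1 inside the double sum
  have h1 : ∑ i ∈ insert p X, ∑ j ∈ insert p X,
      c i * c j * legendreI l (inner ℝ (id i) (id j)) (‖id i‖ ^ 2 * ‖id j‖ ^ 2) =
      ∑ i ∈ insert p X, ∑ j ∈ insert p X, c i * c j * legendreI l ⟪i, j⟫ 1 := by
    refine Finset.sum_congr rfl fun i hi => Finset.sum_congr rfl fun j hj => ?_
    simp only [id]
    rw [hnorm i hi, hnorm j hj]; norm_num
  rw [h1, Finset.sum_insert hpX] at h
  simp_rw [Finset.sum_insert hpX] at h
  rw [Finset.sum_add_distrib] at h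
  -- identify the four pieces
  have e1 : c p * c p * legendreI l ⟪p, p⟫ 1 = β ^ 2 * legendreI l 1 1 := by
    rw [hcp, hpp]; ring
  have e2 : ∑ x ∈ X, c p * c x * legendreI l ⟪p, x⟫ 1 = β * γ * ∑ x ∈ X, legendreI l ⟪p, x⟫ 1 := by
    rw [Finset.mul_sum]
    refine Finset.sum_congr rfl fun x hx => ?_
    rw [hcp, hcx x hx]
  have e3 : ∑ x ∈ X, c x * c p * legendreI l ⟪x, p⟫ 1 = β * γ * ∑ x ∈ X, legendreI l ⟪p, x⟫ 1 := by
    rw [Finset.mul_sum]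
    refine Finset.sum_congr rfl fun x hx => ?_
    rw [hcp, hcx x hx, real_inner_comm x p]; ring
  have e4 : ∑ x ∈ X, ∑ y ∈ X, c x * c y * legendreI l ⟪x, y⟫ 1 =
      γ ^ 2 * ∑ x ∈ X, ∑ y ∈ X, legendreI l ⟪x, y⟫ 1 := by
    rw [Finset.mul_sum]
    refine Finset.sum_congr rfl fun x hx => ?_
    rw [Finset.mul_sum]
    refine Finset.sum_congr rfl fun y hy => ?_
    rw [hcx x hx, hcx y hy]; ring
  rw [e1, e2, e3, e4] at h
  linarith

section Counting

variable {X : Finset (EuclideanSpace ℝ (Fin 3))} {B : Finset (Finset (EuclideanSpace ℝ (Fin 3)))}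

/-- The bonds at a point with exactly four bond partners `w k` are the four points `w k`.
[folklore] -/
theorem filter_bond_eq_image [DecidableEq (EuclideanSpace ℝ (Fin 3))] {v : EuclideanSpace ℝ (Fin 3)}
    {w : Fin 4 → EuclideanSpace ℝ (Fin 3)} (hwX : ∀ k, w k ∈ X)
    (hwB : ∀ k, ({v, w k} : Finset (EuclideanSpace ℝ (Fin 3))) ∈ B)
    (hall : ∀ y, ({v, y} : Finset (EuclideanSpace ℝ (Fin 3))) ∈ B → ∃ k, y = w k) :
    X.filter (fun y => ({v, y} : Finset (EuclideanSpace ℝ (Fin 3))) ∈ B) =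
      Finset.univ.image w := by
  ext y
  simp only [Finset.mem_filter, Finset.mem_image, Finset.mem_univ, true_and]
  constructor
  · rintro ⟨-, hy⟩
    obtain ⟨k, rfl⟩ := hall y hy
    exact ⟨k, rfl⟩
  · rintro ⟨k, rfl⟩
    exact ⟨hwX k, hwB k⟩

/-- **Four bonded partners.** [folklore] -/
theorem card_filter_bond_eq_four [DecidableEq (EuclideanSpace ℝ (Fin 3))] {v : EuclideanSpace ℝ (Fin 3)}
    {w : Fin 4 → EuclideanSpace ℝ (Fin 3)} (hwX : ∀ k, w k ∈ X) (hwinj : Function.Injective w)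
    (hwB : ∀ k, ({v, w k} : Finset (EuclideanSpace ℝ (Fin 3))) ∈ B)
    (hall : ∀ y, ({v, y} : Finset (EuclideanSpace ℝ (Fin 3))) ∈ B → ∃ k, y = w k) :
    (X.filter (fun y => ({v, y} : Finset (EuclideanSpace ℝ (Fin 3))) ∈ B)).card = 4 := by
  rw [filter_bond_eq_image hwX hwB hall, Finset.card_image_of_injective _ hwinj]
  simp

/-- **Seven non-bonded others** at a point of a twelve-point set with four bonds (the point itself
is not bonded to itself since bonds are pairs of distinct points). [folklore] -/
theorem card_filter_nonbond_eq_seven [DecidableEq (EuclideanSpace ℝ (Fin 3))] (hcard : X.card = 12)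
    (hB : ∀ T ∈ B, ∃ u ∈ X, ∃ u' ∈ X, u ≠ u' ∧ 1 - (101 / 100 : ℝ) ^ 2 / 2 ≤ ⟪u, u'⟫ ∧ T = {u, u'})
    {v : EuclideanSpace ℝ (Fin 3)} (hv : v ∈ X)
    {w : Fin 4 → EuclideanSpace ℝ (Fin 3)} (hwX : ∀ k, w k ∈ X) (hwinj : Function.Injective w)
    (hwB : ∀ k, ({v, w k} : Finset (EuclideanSpace ℝ (Fin 3))) ∈ B)
    (hall : ∀ y, ({v, y} : Finset (EuclideanSpace ℝ (Fin 3))) ∈ B → ∃ k, y = w k) :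
    (X.filter (fun y => y ≠ v ∧ ({v, y} : Finset (EuclideanSpace ℝ (Fin 3))) ∉ B)).card = 7 := by
  have hvv : ({v, v} : Finset (EuclideanSpace ℝ (Fin 3))) ∉ B := by
    intro h
    obtain ⟨u, -, u', -, huu', -, hT⟩ := hB _ h
    have h2 : ({u, u'} : Finset (EuclideanSpace ℝ (Fin 3))).card = 2 := Finset.card_pair huu'
    rw [← hT] at h2
    simp at h2
  -- X = {v} ∪ bonded ∪ nonbonded, disjointly
  have hsplit : X = (({v} : Finset (EuclideanSpace ℝ (Fin 3))) ∪
      X.filter (fun y => ({v, y} : Finset (EuclideanSpace ℝ (Fin 3))) ∈ B)) ∪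
      X.filter (fun y => y ≠ v ∧ ({v, y} : Finset (EuclideanSpace ℝ (Fin 3))) ∉ B) := by
    ext y
    simp only [Finset.mem_union, Finset.mem_singleton, Finset.mem_filter]
    constructor
    · intro hy
      by_cases hyv : y = v
      · exact Or.inl (Or.inl hyv)
      · by_cases hyB : ({v, y} : Finset (EuclideanSpace ℝ (Fin 3))) ∈ B
        · exact Or.inl (Or.inr ⟨hy, hyB⟩)
        · exact Or.inr ⟨hy, hyv, hyB⟩
    · rintro ((rfl | ⟨hy, -⟩) | ⟨hy, -⟩)
      · exact hv
      · exact hy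
      · exact hy
  have hd1 : Disjoint ({v} : Finset (EuclideanSpace ℝ (Fin 3)))
      (X.filter (fun y => ({v, y} : Finset (EuclideanSpace ℝ (Fin 3))) ∈ B)) := by
    rw [Finset.disjoint_singleton_left, Finset.mem_filter]
    exact fun h => hvv h.2
  have hd2 : Disjoint ({v} ∪ X.filter (fun y => ({v, y} : Finset (EuclideanSpace ℝ (Fin 3))) ∈ B))
      (X.filter (fun y => y ≠ v ∧ ({v, y} : Finset (EuclideanSpace ℝ (Fin 3))) ∉ B)) := by
    rw [Finset.disjoint_left]
    intro y hy hy'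
    rw [Finset.mem_filter] at hy'
    rcases Finset.mem_union.1 hy with hy | hy
    · exact hy'.2.1 (Finset.mem_singleton.1 hy)
    · exact hy'.2.2 (Finset.mem_filter.1 hy).2
  have hc := congrArg Finset.card hsplit
  rw [Finset.card_union_of_disjoint hd2, Finset.card_union_of_disjoint hd1, Finset.card_singleton,
    card_filter_bond_eq_four hwX hwinj hwB hall, hcard] at hc
  omega

/-- **Splitting a sum at a point with four bonds**: for `v ∈ X`,
`Σ_{y∈X} f y = f v + Σ_{bonded y} f y + Σ_{non-bonded y ≠ v} f y`. [folklore] -/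
theorem sum_split_bond [DecidableEq (EuclideanSpace ℝ (Fin 3))]
    (hB : ∀ T ∈ B, ∃ u ∈ X, ∃ u' ∈ X, u ≠ u' ∧ 1 - (101 / 100 : ℝ) ^ 2 / 2 ≤ ⟪u, u'⟫ ∧ T = {u, u'})
    {v : EuclideanSpace ℝ (Fin 3)} (hv : v ∈ X) (f : EuclideanSpace ℝ (Fin 3) → ℝ) :
    ∑ y ∈ X, f y = f v + ∑ y ∈ X.filter (fun y => ({v, y} : Finset (EuclideanSpace ℝ (Fin 3))) ∈ B), f y
      + ∑ y ∈ X.filter (fun y => y ≠ v ∧ ({v, y} : Finset (EuclideanSpace ℝ (Fin 3))) ∉ B), f y := by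
  have hvv : ({v, v} : Finset (EuclideanSpace ℝ (Fin 3))) ∉ B := by
    intro h
    obtain ⟨u, -, u', -, huu', -, hT⟩ := hB _ h
    have h2 : ({u, u'} : Finset (EuclideanSpace ℝ (Fin 3))).card = 2 := Finset.card_pair huu'
    rw [← hT] at h2
    simp at h2
  have hsplit : X = (({v} : Finset (EuclideanSpace ℝ (Fin 3))) ∪
      X.filter (fun y => ({v, y} : Finset (EuclideanSpace ℝ (Fin 3))) ∈ B)) ∪
      X.filter (fun y => y ≠ v ∧ ({v, y} : Finset (EuclideanSpace ℝ (Fin 3))) ∉ B) := by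
    ext y
    simp only [Finset.mem_union, Finset.mem_singleton, Finset.mem_filter]
    constructor
    · intro hy
      by_cases hyv : y = v
      · exact Or.inl (Or.inl hyv)
      · by_cases hyB : ({v, y} : Finset (EuclideanSpace ℝ (Fin 3))) ∈ B
        · exact Or.inl (Or.inr ⟨hy, hyB⟩)
        · exact Or.inr ⟨hy, hyv, hyB⟩
    · rintro ((rfl | ⟨hy, -⟩) | ⟨hy, -⟩)
      · exact hv
      · exact hy
      · exact hy
  have hd1 : Disjoint ({v} : Finset (EuclideanSpace ℝ (Fin 3)))
      (X.filter (fun y => ({v, y} : Finset (EuclideanSpace ℝ (Fin 3))) ∈ B)) := by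
    rw [Finset.disjoint_singleton_left, Finset.mem_filter]
    exact fun h => hvv h.2
  have hd2 : Disjoint ({v} ∪ X.filter (fun y => ({v, y} : Finset (EuclideanSpace ℝ (Fin 3))) ∈ B))
      (X.filter (fun y => y ≠ v ∧ ({v, y} : Finset (EuclideanSpace ℝ (Fin 3))) ∉ B)) := by
    rw [Finset.disjoint_left]
    intro y hy hy'
    rw [Finset.mem_filter] at hy'
    rcases Finset.mem_union.1 hy with hy | hy
    · exact hy'.2.1 (Finset.mem_singleton.1 hy)
    · exact hy'.2.2 (Finset.mem_filter.1 hy).2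
  conv_lhs => rw [hsplit]
  rw [Finset.sum_union hd2, Finset.sum_union hd1, Finset.sum_singleton]

end Counting

end Summit.AtomisticToContinuum.Crystallization.Theorems.Cap
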